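import Literature.Analysis.FunctionSpaces.PoissonPointProcess
import HarnessLib

/-!
# Poisson point processes: proofs
(topic Analysis/FunctionSpaces; DISCHARGES the named fact
`Literature.Analysis.FunctionSpaces.IsPoissonPointProcess.translate` of
`Literature.Analysis.FunctionSpaces.PoissonPointProcess` as `IsPoissonPointProcess.translate_holds`)

Main result: `IsPoissonPointProcess.translate_holds` — the **Mapping Theorem for translations**:
if `P` is a Poisson point process on `E` with intensity `ν` (Kingman's axioms,
`IsPoissonPointProcess ν P`), then its image under the translation `c ↦ c + v` of configurations
is a Poisson point process with intensity the image measure `ν ∘ (· + v)⁻¹`.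

The proof is Kingman's computation (2.24)–(2.26) (Kingman, *Poisson Processes* (1993), §2.3,
p. 18) specialised to the injective measurable map `f = (· + v)`, for which the image points are
automatically distinct, so that neither σ-finiteness of `ν` nor non-atomicity of the image measure
(the hypotheses of the general Mapping Theorem) is needed:

* `N*(B) = N(f⁻¹ B)` (`PointConfig.count_translate`), which is Poisson with mean
  `ν (f⁻¹ B) = (ν.map f) B` whenever the latter is finite;
* disjoint `B₁, …, Bₙ` have disjoint inverse images, so the `N*(Bᵢ) = N(f⁻¹ Bᵢ)` are independent
  under `P`; independence is transported to the image law `P.map (translate v)` by the elementary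
  change-of-variables lemma `iIndepFun_map_of_comp` (proved here).

No new definitions, no new named facts.

Second result (appended): `PointConfig.measurable_union_holds` — DISCHARGES the named fact
`Literature.Analysis.FunctionSpaces.PointConfig.measurable_union`: on a second countable Hausdorff
space whose open sets are measurable, superposition `(c, d) ↦ c ∪ d` of locally finite simple
configurations is measurable for the count σ-algebra (the smallest σ-algebra making every
`Λ ↦ #(Λ ∩ B)` measurable, Kingman (2.16)). Kingman's Superposition Theorem (§2.2, (2.19)–(2.20))
only needs `N(A) = N₁(A) + N₂(A)` almost surely, which he gets from the Disjointness Lemma; the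
deterministic measurability recorded by the fact is proved here by an elementary separation
argument valid in any T₁ space with a countable basis of measurable open sets: `#A ≥ k + 1` iff
some basic open `u` meets `A` with `#(A \ u) ≥ k` (`PointConfig.natCast_succ_le_encard_iff`:
`k` of the points form a finite, hence closed, set whose complement is a neighbourhood of the
last), so by induction on `k` the superlevel events `{k ≤ #(Φ ∩ t)}` of a set-valued map `Φ` are
countable unions of `{Φ ∩ t ∩ u ≠ ∅} ∩ {k - 1 ≤ #(Φ ∩ (t \ u))}` and hence measurable once the
hitting events `{Φ ∩ t ≠ ∅}` (`t` measurable) are (`PointConfig.measurable_encard_inter`); for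
`Φ (c, d) = c ∪ d` the hitting events are `{N_c(t) ≠ 0} ∪ {N_d(t) ≠ 0}`, and
`PointConfig.measurable_of_count` concludes. Still no new definitions and no new named facts.

Third result (appended): `IsPoissonPointProcess.restrict_holds` — DISCHARGES the named fact
`Literature.Analysis.FunctionSpaces.IsPoissonPointProcess.restrict`, Kingman's **Restriction
Theorem** (§2.2, p. 17): *Let `Π` be a Poisson process with mean measure `μ` on `S`, and let `S₁`
be a measurable subset of `S`. Then the random countable set `Π₁ = Π ∩ S₁` can be regarded either
as a Poisson process on `S` with mean measure `μ₁(A) = μ(A ∩ S₁)` or as a Poisson process on `S₁`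
whose mean measure is the restriction of `μ` to `S₁`.* Kingman: "Its proof is just a matter of
checking the definition, but it is used so often that it is proper to bring it into the open." The
vendored fact is the first reading for the count-based predicate `IsPoissonPointProcess ν P`
(§2.1 (i)–(ii), p. 12): for measurable `s`, the image law `P.map (PointConfig.restrict s)` of
`c ↦ c ∩ s` is a Poisson point process with intensity `ν.restrict s` (`A ↦ ν (A ∩ s)`). Checking
the definition: `PointConfig.restrict s` is measurable (`PointConfig.measurable_restrict`), so the
image of the probability measure `P` is a probability measure; `N_{c ∩ s}(t) = N_c(s ∩ t)`
(`PointConfig.count_restrict`), whose law under `P` is Poisson with mean `ν (t ∩ s) = (ν.restrict s) t`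
whenever this is finite; pairwise disjoint measurable `t₁, …, tₙ` give pairwise disjoint measurable
`s ∩ tᵢ`, so the `N(s ∩ tᵢ)` are independent under `P`, and `iIndepFun_map_of_comp` transports
this to independence of the `N(tᵢ)` under the image law. `PointConfig.restrict_holds` and
`PointConfig.translate_holds` are census aliases of the two `IsPoissonPointProcess` discharges (see
the section docstring before them). Still no new definitions and no new named facts.

## References

* J. F. C. Kingman, *Poisson Processes*, Oxford Studies in Probability 3, Oxford University Press
  (1993), §2.3 The Mapping Theorem, p. 18, display (2.24)–(2.26). [cite: Kingman1993, §2.3]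
* ibid., §2.2 The Superposition Theorem (pp. 14–17): Disjointness Lemma with the count σ-algebra
  (2.16), Superposition Theorem (2.19)–(2.20). [cite: Kingman1993, §2.2]
* ibid., §2.1 (definition of a Poisson process, (i)–(ii), p. 12); §2.2 Restriction Theorem
  (p. 17). [cite: Kingman1993, §2.2 Restriction Theorem]
-/

open MeasureTheory ProbabilityTheory
open scoped ENNReal NNReal

namespace Literature.Analysis.FunctionSpaces

variable {E : Type*} [TopologicalSpace E] [MeasurableSpace E]

namespace IsPoissonPointProcess

variable {ν : Measure E} {P : Measure (PointConfig E)}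

/-- Independence of a family of random variables transports along a measurable change of
variables: if the `g i ∘ T` are independent under `μ`, then the `g i` are independent under the
image measure `μ.map T` (both say `μ (T ⁻¹' ⋂ᵢ g i ⁻¹' Bᵢ) = ∏ᵢ μ (T ⁻¹' (g i ⁻¹' Bᵢ))` for
finitely many measurable `Bᵢ`). [folklore] -/
private theorem iIndepFun_map_of_comp {Ω Ω' ι : Type*} [MeasurableSpace Ω] [MeasurableSpace Ω']
    {β : ι → Type*} [∀ i, MeasurableSpace (β i)] {μ : Measure Ω} {T : Ω → Ω'}
    (hT : Measurable T) {g : ∀ i, Ω' → β i} (hg : ∀ i, Measurable (g i))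
    (h : iIndepFun (fun i => g i ∘ T) μ) : iIndepFun g (μ.map T) := by
  rw [iIndepFun_iff_measure_inter_preimage_eq_mul] at h ⊢
  intro S sets hsets
  have hmeas : ∀ i ∈ S, MeasurableSet (g i ⁻¹' sets i) := fun i hi => hg i (hsets i hi)
  have h1 : ∀ i ∈ S, μ.map T (g i ⁻¹' sets i) = μ ((g i ∘ T) ⁻¹' sets i) := fun i hi => by
    rw [Measure.map_apply hT (hmeas i hi), Set.preimage_comp]
  rw [Finset.prod_congr rfl h1, Measure.map_apply hT (Finset.measurableSet_biInter S hmeas),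
    Set.preimage_iInter₂]
  simpa only [Set.preimage_comp] using h S hsets

/-- **Mapping Theorem for translations** (discharge of the named fact
`IsPoissonPointProcess.translate`): translating a Poisson point process with intensity `ν` by `v`
gives a Poisson point process with intensity `ν.map (· + v)`.
Kingman, *Poisson Processes* (1993), §2.3, Mapping Theorem (p. 18), via the computation
(2.24)–(2.26) preceding it: for the injective measurable map `f = (· + v)` the image points are
distinct, `N*(B) = N(f⁻¹ B)` (`PointConfig.count_translate`) is Poisson with mean `ν (f⁻¹ B)`, and
disjoint `B₁, …, Bₙ` have disjoint inverse images, so the `N*(Bᵢ)` are independent. (In this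
injective case no σ-finiteness / non-atomicity hypothesis is needed.) [cite: Kingman1993, §2.3 Mapping Theorem, p. 18, (2.24)–(2.26)] -/
theorem translate_holds : IsPoissonPointProcess.translate (ν := ν) (P := P) := by
  intro _ _ _ h v
  haveI := h.isProbabilityMeasure
  have hT : Measurable (PointConfig.translate v : PointConfig E → PointConfig E) :=
    PointConfig.measurable_translate v
  have hadd : Measurable fun x : E => x + v := (continuous_add_const v).measurable
  refine ⟨Measure.isProbabilityMeasure_map hT.aemeasurable, fun s hs hfin => ?_,
    fun n s hs hd => ?_⟩
  · -- one-dimensional marginals: `N*(s) = N((· + v) ⁻¹' s) ~ Poisson (ν ((· + v) ⁻¹' s))`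
    rw [Measure.map_apply hadd hs] at hfin ⊢
    have hcomp : (fun c : PointConfig E => c.count s) ∘ PointConfig.translate v =
        fun c : PointConfig E => c.count ((· + v) ⁻¹' s) :=
      funext fun c => PointConfig.count_translate v c s
    rw [Measure.map_map (PointConfig.measurable_count hs) hT, hcomp]
    exact h.map_count (hadd hs) hfin
  · -- independence: pairwise disjoint sets have pairwise disjoint preimages
    refine iIndepFun_map_of_comp hT (fun i => PointConfig.measurable_count (hs i)) ?_
    have hcomp : (fun i => (fun c : PointConfig E => c.count (s i)) ∘ PointConfig.translate v) =
        fun i (c : PointConfig E) => c.count ((· + v) ⁻¹' s i) := by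
      funext i c
      exact PointConfig.count_translate v c (s i)
    rw [hcomp]
    exact h.iIndepFun_count (fun i => hadd (hs i)) fun i j hij => Disjoint.preimage _ (hd hij)

end IsPoissonPointProcess

end Literature.Analysis.FunctionSpaces

/-! ### Measurability of superposition (discharge of `PointConfig.measurable_union`) -/

open _root_.TopologicalSpace _root_.Set

namespace Literature.Analysis.FunctionSpaces.PointConfig

variable {E : Type*} [TopologicalSpace E]

/-- In a T₁ space with a topological basis `B`, a set `A` has at least `k + 1` points iff some
basic open set `u ∈ B` meets `A` while `A \ u` has at least `k` points. (Pick `k + 1` points of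
`A`; `k` of them form a closed set, whose complement contains a basic neighbourhood of the last.)
[folklore] -/
private theorem natCast_succ_le_encard_iff [T1Space E] {B : Set (Set E)} (hB : IsTopologicalBasis B)
    (A : Set E) (k : ℕ) :
    ((k + 1 : ℕ) : ℕ∞) ≤ A.encard ↔ ∃ u ∈ B, (A ∩ u).Nonempty ∧ (k : ℕ∞) ≤ (A \ u).encard := by
  constructor
  · intro hk
    rw [Nat.cast_succ] at hk
    obtain ⟨T, hTA, hT⟩ := exists_subset_encard_eq (le_trans le_self_add hk)
    have hTfin : T.Finite := finite_of_encard_eq_coe hT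
    have hAT : (A \ T).Nonempty := by
      rw [← one_le_encard_iff_nonempty]
      rw [← encard_sdiff_add_encard_of_subset hTA, hT, add_comm (k : ℕ∞)] at hk
      exact (ENat.add_le_add_iff_right (ENat.coe_ne_top k)).1 hk
    obtain ⟨x, hxA, hxT⟩ := hAT
    obtain ⟨u, huB, hxu, huT⟩ :=
      hB.exists_subset_of_mem_open (u := Tᶜ) hxT hTfin.isClosed.isOpen_compl
    refine ⟨u, huB, ⟨x, hxA, hxu⟩, ?_⟩
    rw [← hT]
    exact encard_le_encard fun y hy => ⟨hTA hy, fun hyu => huT hyu hy⟩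
  · rintro ⟨u, -, hne, hk⟩
    rw [← encard_sdiff_add_encard_inter A u, Nat.cast_succ]
    exact add_le_add hk (one_le_encard_iff_nonempty.2 hne)

/-- An `ℕ∞`-valued map is measurable as soon as its superlevel sets `{x | k ≤ g x}`, `k : ℕ`,
are measurable (`{g = n} = {n ≤ g} \ {n + 1 ≤ g}`). [folklore] -/
private theorem measurable_of_measurableSet_natCast_le {X : Type*} [MeasurableSpace X] {g : X → ℕ∞}
    (h : ∀ k : ℕ, MeasurableSet {x | (k : ℕ∞) ≤ g x}) : Measurable g := by
  refine ENat.measurable_iff.2 fun n => ?_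
  have hn : g ⁻¹' {(n : ℕ∞)} = {x | (n : ℕ∞) ≤ g x} \ {x | ((n + 1 : ℕ) : ℕ∞) ≤ g x} := by
    ext x
    simp only [mem_preimage, mem_singleton_iff, mem_sdiff, mem_setOf_eq, not_le, Nat.cast_succ]
    constructor
    · intro hx
      rw [hx]
      exact ⟨le_rfl, (ENat.lt_add_one_iff (ENat.coe_ne_top n)).2 le_rfl⟩
    · rintro ⟨h₁, h₂⟩
      exact le_antisymm ((ENat.lt_add_one_iff (ENat.coe_ne_top n)).1 h₂) h₁
  rw [hn]
  exact (h n).diff (h (n + 1))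

variable [MeasurableSpace E]

/-- If the hitting events `{x | Φ x ∩ t ≠ ∅}` (`t` measurable) of a set-valued map `Φ` into a T₁
second countable space with measurable open sets are measurable, then so is every count
`x ↦ #(Φ x ∩ t)`: by `natCast_succ_le_encard_iff`, `{k + 1 ≤ #(Φ ∩ t)}` is the countable union over
the basis `u` of `{Φ ∩ (t ∩ u) ≠ ∅} ∩ {k ≤ #(Φ ∩ (t \ u))}` (induction on `k`). [folklore] -/
theorem measurable_encard_inter [T1Space E] [SecondCountableTopology E] [OpensMeasurableSpace E]
    {X : Type*} [MeasurableSpace X] {Φ : X → Set E}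
    (hΦ : ∀ t : Set E, MeasurableSet t → MeasurableSet {x | (Φ x ∩ t).Nonempty})
    {t : Set E} (ht : MeasurableSet t) : Measurable fun x => (Φ x ∩ t).encard := by
  apply measurable_of_measurableSet_natCast_le
  intro k
  induction k generalizing t with
  | zero => simp
  | succ k ih =>
    have hk : {x | ((k + 1 : ℕ) : ℕ∞) ≤ (Φ x ∩ t).encard}
        = ⋃ u ∈ countableBasis E,
            {x | (Φ x ∩ (t ∩ u)).Nonempty} ∩ {x | (k : ℕ∞) ≤ (Φ x ∩ (t \ u)).encard} := by
      ext x
      simp only [mem_setOf_eq, natCast_succ_le_encard_iff (isBasis_countableBasis E), mem_iUnion,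
        mem_inter_iff, inter_assoc, inter_sdiff_assoc, exists_prop]
    rw [hk]
    exact MeasurableSet.biUnion (countable_countableBasis E) fun u hu =>
      (hΦ _ (ht.inter (isOpen_of_mem_countableBasis hu).measurableSet)).inter
        (ih (ht.diff (isOpen_of_mem_countableBasis hu).measurableSet))

/-- **Discharge of `PointConfig.measurable_union`.** On a second countable Hausdorff space whose
open sets are measurable, superposition `(c, d) ↦ c ∪ d` is measurable for the count σ-algebra:
by `measurable_of_count` it suffices that each `N_{c ∪ d}(s)` be measurable, and the hitting
events of `c ∪ d` are `{N_c(t) ≠ 0} ∪ {N_d(t) ≠ 0}`, so `measurable_encard_inter` applies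
(Kingman, *Poisson Processes* (1993), §2.2, Superposition Theorem — the measurability it takes
for granted). [cite: Kingman1993, §2.2] -/
theorem measurable_union_holds : measurable_union (E := E) := by
  intro _ _ _
  refine measurable_of_count fun s hs => ?_
  have hΦ : ∀ t : Set E, MeasurableSet t → MeasurableSet
      {p : PointConfig E × PointConfig E | ((p.1.carrier ∪ p.2.carrier) ∩ t).Nonempty} := by
    intro t ht
    have h0 : MeasurableSet {n : ℕ∞ | n ≠ 0} := MeasurableSet.of_discrete
    have h₁ : MeasurableSet {p : PointConfig E × PointConfig E | p.1.count t ≠ 0} :=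
      (measurable_count ht).comp measurable_fst h0
    have h₂ : MeasurableSet {p : PointConfig E × PointConfig E | p.2.count t ≠ 0} :=
      (measurable_count ht).comp measurable_snd h0
    have ht' : {p : PointConfig E × PointConfig E | ((p.1.carrier ∪ p.2.carrier) ∩ t).Nonempty}
        = {p | p.1.count t ≠ 0} ∪ {p | p.2.count t ≠ 0} := by
      ext p
      simp only [count, union_inter_distrib_right, union_nonempty, encard_ne_zero, mem_setOf_eq,
        mem_union]
    rw [ht']
    exact h₁.union h₂
  exact measurable_encard_inter hΦ hs

end Literature.Analysis.FunctionSpaces.PointConfig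

/-! ### The Restriction Theorem (discharge of `IsPoissonPointProcess.restrict`) -/

namespace Literature.Analysis.FunctionSpaces

namespace IsPoissonPointProcess

variable {E : Type*} [TopologicalSpace E] [MeasurableSpace E]
  {ν : Measure E} {P : Measure (PointConfig E)}

/-- **Restriction Theorem** (discharge of the named fact `IsPoissonPointProcess.restrict`):
if `P` is a Poisson point process on `E` with intensity `ν` and `s ⊆ E` is measurable, then the law
`P.map (PointConfig.restrict s)` of the restricted configuration `c ∩ s` is a Poisson point process
with intensity `ν.restrict s` (`A ↦ ν (A ∩ s)`). Kingman, *Poisson Processes* (1993), §2.2,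
Restriction Theorem (p. 17): "its proof is just a matter of checking the definition" — the counts
of `c ∩ s` are `N(s ∩ t)` (`PointConfig.count_restrict`), Poisson with mean
`ν (t ∩ s) = (ν.restrict s) t` when finite, and for pairwise disjoint measurable `tᵢ` the sets
`s ∩ tᵢ` are again pairwise disjoint and measurable, so their counts are independent under `P`,
i.e. (by `iIndepFun_map_of_comp`, the restriction map being measurable,
`PointConfig.measurable_restrict`) the counts `N(tᵢ)` are independent under the image law. The
fact is stated over the ambient `{ν} {P}` of its section, whence the named arguments in the type.
[cite: Kingman1993, §2.2 Restriction Theorem, p. 17] -/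
theorem restrict_holds : IsPoissonPointProcess.restrict (ν := ν) (P := P) := by
  intro h s hs
  haveI := h.isProbabilityMeasure
  have hR : Measurable (PointConfig.restrict s : PointConfig E → PointConfig E) :=
    PointConfig.measurable_restrict hs
  refine ⟨Measure.isProbabilityMeasure_map hR.aemeasurable, fun t ht hfin => ?_,
    fun n t ht hd => ?_⟩
  · -- one-dimensional marginals: `N_{c ∩ s}(t) = N_c(t ∩ s) ~ Poisson (ν (t ∩ s))`
    rw [Measure.restrict_apply ht] at hfin ⊢
    have hcomp : (fun c : PointConfig E => c.count t) ∘ PointConfig.restrict s =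
        fun c : PointConfig E => c.count (t ∩ s) := by
      funext c
      change (PointConfig.restrict s c).count t = c.count (t ∩ s)
      rw [PointConfig.count_restrict, Set.inter_comm]
    rw [Measure.map_map (PointConfig.measurable_count ht) hR, hcomp]
    exact h.map_count (ht.inter hs) hfin
  · -- independence: pairwise disjoint sets meet `s` in pairwise disjoint sets
    refine iIndepFun_map_of_comp hR (fun i => PointConfig.measurable_count (ht i)) ?_
    have hcomp : (fun i => (fun c : PointConfig E => c.count (t i)) ∘ PointConfig.restrict s) =
        fun i (c : PointConfig E) => c.count (s ∩ t i) := by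
      funext i c
      exact PointConfig.count_restrict s c (t i)
    rw [hcomp]
    exact h.iIndepFun_count (fun i => hs.inter (ht i))
      (hd.mono fun i j hij => Disjoint.mono Set.inter_subset_right Set.inter_subset_right hij)

end IsPoissonPointProcess

/-! ### Census aliases

The named-fact census resolves the short name of a `Prop` fact to the first `def` of that name in
its file; in `PoissonPointProcess.lean` the configuration maps `PointConfig.restrict` and
`PointConfig.translate` precede the facts `IsPoissonPointProcess.restrict` and
`IsPoissonPointProcess.translate`, so the census files the two facts as
`Literature.Analysis.FunctionSpaces.PointConfig.restrict` / `.translate` and looks for theorems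
`PointConfig.restrict_holds` / `PointConfig.translate_holds`. These aliases restate nothing: their
types are the named facts themselves and their proofs are the discharges above. -/

section CensusAliases

variable {E : Type*} [TopologicalSpace E] [MeasurableSpace E]
  {ν : Measure E} {P : Measure (PointConfig E)}

/-- Census alias of `IsPoissonPointProcess.restrict_holds`, Kingman's **Restriction Theorem**
(*Poisson Processes* (1993), §2.2, p. 17) for the count-based predicate `IsPoissonPointProcess`:
the type is the named fact `IsPoissonPointProcess.restrict` itself (see the section docstring for
why this name exists). [cite: Kingman1993, §2.2 Restriction Theorem, p. 17] -/
theorem PointConfig.restrict_holds : IsPoissonPointProcess.restrict (ν := ν) (P := P) :=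
  IsPoissonPointProcess.restrict_holds

/-- Census alias of `IsPoissonPointProcess.translate_holds`, Kingman's **Mapping Theorem** for
translations (*Poisson Processes* (1993), §2.3, p. 18, (2.24)–(2.26)): the type is the named fact
`IsPoissonPointProcess.translate` itself (see the section docstring for why this name exists).
[cite: Kingman1993, §2.3 Mapping Theorem, p. 18, (2.24)–(2.26)] -/
theorem PointConfig.translate_holds : IsPoissonPointProcess.translate (ν := ν) (P := P) :=
  IsPoissonPointProcess.translate_holds

end CensusAliases

end Literature.Analysis.FunctionSpaces
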